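import Literature.AnabelianGeometry.EtaleTheta.SettingModelChiLevelKernels
import Literature.AnabelianGeometry.EtaleTheta.SettingModelChiCoverings
import Literature.AnabelianGeometry.EtaleTheta.SettingModelSec2Hyps
import HarnessLib

/-!
# The χ-twisted root model of [EtTh] §1 satisfies the §2 hypotheses record `Sec2Hyps` (record-free half)
# (R78 cluster, hand #2; proof-only)

Mochizuki, *The étale theta function …*, Publ. RIMS **45** (2009) [EtTh], Def. 2.5 p. 39 ("`K = K̈`") and §1
p. 13 ("`G_{K_N} ↪ (Π^tp_Y)^ell/N·(Δ^tp_Y)^ell` … determines a Galois covering `Y_N → Y`", whence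
`Π^tp_{Y_N} ⊇ Ker(Π^tp_Y ↠ (Π^tp_Y)^ell)`) [cite: MochizukiEtTh2009, Def 2.5 p.39].  abc-iut cell, layer L2,
prover abc-iut-L2-d1 (gen 4), R78 cluster hand #2 (L2-lead RULINGS #13 R100), over abc-iut-w5-d249's F4
(`curveχ`, `PiTpχ = Γ ⋊_χ G_{ℚ_p}`), abc-iut-L2-t1's F5a (`YNχ`, `chiTwistData.toZ`) and this seat's
`SettingModelChiLevelKernels` (`mem_ellKerχ_iff`) / `SettingModelSec2Hyps` (`fieldKN_bot_two_of_sq`).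

The two clauses of abc-iut-L2-t8's `ThetaSetting.Sec2Hyps` for the χ-model, stated over the CONSTITUENTS (the
record `ThetaSetting.modelχ` is abc-iut-L2-t1's F5b; the record-level corollary `modelχ_sec2Hyps` is the two-line
sequel once it lands):
* `fieldKN_bot_qModel_two` — `K̈ = ℚ_p(±1, ±p) = ℚ_p = K` (`Kdd_eq`);
* **`ellKerχ_inf_ker_toZ_le_YNχ`** — `Ker(Π^tp_X ↠ (Π^tp_X)^ell) ∩ Π^tp_Y ≤ Π^tp_{Y_N}` for every `N`: an element
  of `CurveTheta.ellKer (curveχ p)` has `right = 1` and all levels `ĥ_N(pr₁ ·)` with `x = y = 0`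
  (`mem_ellKerχ_iff`), and degree `0` by the `Π^tp_Y`-hypothesis, hence lies in `Δ^tp_{Y_N} ⋊ G_{K_N} = YNχ N`
  (`ker_toEll_le_GtpYN`).
Semi-synthetic model, consistency evidence only; nothing of [EtTh] asserted; no side taken on [IUTchIII] Cor. 3.12.
-/

noncomputable section

namespace Literature.AnabelianGeometry.EtaleTheta.SettingModel

open Literature.AnabelianGeometry.SemiGraphs IntermediateField

variable (p : ℕ) [Fact p.Prime]

/-- **`K̈ = K` for the χ-model's field data** (`K := ℚ_p`, `q_X := qModel p = p²`): `fieldKN ⊥ (p²) 2 = ⊥`.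
[cite: MochizukiEtTh2009, Def 2.5 p.39] -/
theorem fieldKN_bot_qModel_two : fieldKN ⊥ (qModel p) 2 = (⊥ : IntermediateField ℚ_[p] (PadicAlgCl p)) :=
  fieldKN_bot_two_of_sq p (IntermediateField.natCast_mem _ p)

/-- **`Ker(Π^tp_X ↠ (Π^tp_X)^ell) ∩ Π^tp_Y ≤ Π^tp_{Y_N}` at the χ-model**, for every `N`: the clause
`Sec2Hyps.ker_toEll_le_GtpYN` over the constituents `CurveTheta.ellKer (curveχ p)` (= the kernel of
`thetaToEll ∘ toTheta`, `CurveTheta.ker_toEll`), `(chiTwistData p).toZ` and `YNχ p N`.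
[cite: MochizukiEtTh2009, §1 p.13] -/
theorem ellKerχ_inf_ker_toZ_le_YNχ (N : ℕ+) :
    CurveTheta.ellKer (curveχ p) ⊓ (chiTwistData p).toZ.ker ≤ YNχ p N := by
  intro g hg
  obtain ⟨hg1, hgZ⟩ := Subgroup.mem_inf.mp hg
  obtain ⟨hxy, hright⟩ := (mem_ellKerχ_iff p g).mp hg1
  rw [MonoidHom.mem_ker, GfpTwistData.toZ_apply] at hgZ
  refine (GfpTwistData.mem_YN _).mpr ⟨⟨hgZ, ?_⟩, ?_⟩
  · -- `levelHom N g.left = ĥ_N(pr₁ g.left) ∈ {x = 0, y = 0}`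
    change levelHom N g.left ∈ (Heis.zAxis : Subgroup (Heis (ZMod N)))
    exact hxy N
  · rw [hright]
    exact Subgroup.one_mem _

/-- The same with the kernel of the composite `(thetaToEll ∘ toTheta)` of `CurveTheta` spelled out (the shape of the
root field). [cite: MochizukiEtTh2009, §1 p.13] -/
theorem ker_thetaToEll_comp_toTheta_inf_ker_toZ_le_YNχ (N : ℕ+) :
    ((CurveTheta.thetaToEll (curveχ p)).comp (CurveTheta.toTheta (curveχ p))).ker ⊓
        (chiTwistData p).toZ.ker ≤ YNχ p N := by
  rw [CurveTheta.ker_toEll]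
  exact ellKerχ_inf_ker_toZ_le_YNχ p N

/-- A fortiori `Ker(Π^tp_X ↠ (Π^tp_X)^Θ) ∩ Π^tp_Y ≤ Π^tp_{Y_N}`. [cite: MochizukiEtTh2009, §1 p.13] -/
theorem thetaKerχ_inf_ker_toZ_le_YNχ (N : ℕ+) :
    CurveTheta.thetaKer (curveχ p) ⊓ (chiTwistData p).toZ.ker ≤ YNχ p N :=
  le_trans (inf_le_inf_right _ (CurveTheta.thetaKer_le_ellKer _)) (ellKerχ_inf_ker_toZ_le_YNχ p N)

end Literature.AnabelianGeometry.EtaleTheta.SettingModel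

end
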